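import Mathlib
import Summits.NavierStokesRegularity.NavierStokesRegularity.Theorems.FilamentSkeletonRssSkeletonJ1RFrameDefs
import Summits.NavierStokesRegularity.NavierStokesRegularity.Theorems.FilamentSkeletonRssSkeletonJ1RLiaShooting
import Summits.NavierStokesRegularity.NavierStokesRegularity.Theorems.FilamentSkeletonRssSelectionBoxRJRungBending

/-!
# Route `FilamentSkeletonRss` · crux `SkeletonJ1R` (stmt-NavierStokesRegularity-23610) · registered line `streamline_kantorovich_R`
# — brick F(i)-c for stub F `LiaFrameL`: THE LIA REFERENCE EXISTS (global IVP), is unique, and obeys the pointwise curvature / flatness laws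

Lead `ns-fsr-lead-23610` (g0), `--supports stmt-NavierStokesRegularity-23610 --as helper`.  First brick ABOUT the landed line vocabulary
(`…SkeletonJ1RFrameDefs`, p711824): instantiates the Γ-free shooting brick `…SkeletonJ1RLiaShooting` (p712316) to `IsLiaReference`.

CONTENTS.
* `ambientField_eq` — under `‖t k‖ = 1` the ambient field of filament `j` (regularised Biot–Savart field of the partners' straight datum lines, core
  constant `a₀ = exp(−(1+γ_E−log 2))`, plus `½y − αe₃×y`) is the EXPLICIT rational expression
  `Σ_{k ≠ j} (Γγ_k/4π) • (2/(d_k(y)² + a₀)) • t_k × (y − W_k) + ½y − αe₃×y`, `W_k` the scaled waist point, `d_k(y)` the distance to line `k`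
  (`lineBiotSavart_core`); hence `contDiff_ambientField` (`C^∞`) and the size bound `norm_ambientField_le` (`≤ Σ_{k≠j} (Γ|γ_k|/4π)(2/d) + (½+|α|)‖y‖`
  seen from distance `≥ d` of every partner line).
* `contDiff_switchWeight` / `contDiff_refCutoff`, `switchWeight_nonneg` / `switchWeight_le_one` (the smooth switch is `[0,1]`-valued and `C^∞`).
* `liaReference_exists` / `liaReference_unique` — for every datum with unit directions and every `Γ, Rb, γ, α, s₀` THE LIA reference
  `IsLiaReference Γ Rb p t γ α s₀ x` exists and is unique (`positionCutoffLia_exists/unique` filament by filament).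
* `IsLiaReference.norm_iteratedDeriv_two_le` — `‖x_j″ τ‖ ≤ |β_j⁻¹| ‖W_j(x_j τ)‖` (cutoff in `[0,1]`, unit tangent);
  `IsLiaReference.iteratedDeriv_two_eq_zero` — `x_j″ τ = 0` wherever `3ℓ² ≤ ‖x_j τ‖²` (`ℓ = Rb√(Γ log Γ) ≠ 0`): the arms are straight.

HONEST FRAMING.  ODE bookkeeping for the ∃-side of a HYPOTHETICAL filament-type rotating-self-similar blow-up skeleton (MODEL rung, negative side);
nothing here is a claim about Navier–Stokes regularity or blow-up; stub F and the crux stay OPEN.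
-/

set_option linter.dupNamespace false -- `NavierStokesRegularity.NavierStokesRegularity` path/namespace repetition is the tree convention

noncomputable section

namespace Summit.NavierStokesRegularity.NavierStokesRegularity.Theorems.SkeletonJ1RFrame

open Set Function Filter MeasureTheory Real Topology
open Literature.Analysis.FluidPDE
open Summit.NavierStokesRegularity.NavierStokesRegularity.Theorems.SelectionBoxRJRung
open scoped InnerProductSpace BigOperators

/-! ## §1 The ambient field in closed form -/

/-- The crux's core constant `a₀ = exp(−(1+γ_E−log 2))·1` is positive. [folklore] -/
theorem coreConst_pos : 0 < Real.exp (-(1+Real.eulerMascheroniConstant-Real.log 2)) * (1:ℝ) := by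
  rw [mul_one]; exact Real.exp_pos _

/-- **Closed form of the ambient field** (unit datum directions): the partners' line integrals are the Lorentzians of `lineBiotSavart_core`. [folklore] -/
theorem ambientField_eq {N : ℕ} (Γ : ℝ) (p t : Fin N → EuclideanSpace ℝ (Fin 3)) (γ : Fin N → ℝ) (α : ℝ) (s₀ : Fin N → ℝ)
    (ht : ∀ k, ‖t k‖ = 1) (j : Fin N) (y : EuclideanSpace ℝ (Fin 3)) :
    ambientField Γ p t γ α s₀ j y =
      (∑ k ∈ Finset.univ.erase j, (Γ*γ k/(4*Real.pi)) •
        ((2 / (‖y - waistPt Γ p t s₀ k‖ ^ 2 - (inner ℝ (y - waistPt Γ p t s₀ k) (t k)) ^ 2 +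
          Real.exp (-(1+Real.eulerMascheroniConstant-Real.log 2)) * (1:ℝ))) • cross (t k) (y - waistPt Γ p t s₀ k))) +
      (1/2:ℝ) • y - α • cross (EuclideanSpace.single 2 1) y := by
  have hk : ∀ k : Fin N, (∫ σ:ℝ, ((‖y - (waistPt Γ p t s₀ k + σ • t k)‖^2 +
      Real.exp (-(1+Real.eulerMascheroniConstant-Real.log 2))*(1:ℝ))^(3/2:ℝ))⁻¹ • cross (t k) (y - (waistPt Γ p t s₀ k + σ • t k))) =
      (2 / (‖y - waistPt Γ p t s₀ k‖ ^ 2 - (inner ℝ (y - waistPt Γ p t s₀ k) (t k)) ^ 2 +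
          Real.exp (-(1+Real.eulerMascheroniConstant-Real.log 2)) * (1:ℝ))) • cross (t k) (y - waistPt Γ p t s₀ k) :=
    fun k => (lineBiotSavart_core coreConst_pos (waistPt Γ p t s₀ k) (t k) y (ht k)).2
  simp only [ambientField, datumLine, hk]

/-- The ambient field is `C^∞` (unit datum directions). [folklore] -/
theorem contDiff_ambientField {N : ℕ} (Γ : ℝ) (p t : Fin N → EuclideanSpace ℝ (Fin 3)) (γ : Fin N → ℝ) (α : ℝ) (s₀ : Fin N → ℝ)
    (ht : ∀ k, ‖t k‖ = 1) (j : Fin N) {n : WithTop ℕ∞} : ContDiff ℝ n (ambientField Γ p t γ α s₀ j) := by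
  have hfun : ambientField Γ p t γ α s₀ j = fun y =>
      (∑ k ∈ Finset.univ.erase j, (Γ*γ k/(4*Real.pi)) •
        ((2 / (‖y - waistPt Γ p t s₀ k‖ ^ 2 - (inner ℝ (y - waistPt Γ p t s₀ k) (t k)) ^ 2 +
          Real.exp (-(1+Real.eulerMascheroniConstant-Real.log 2)) * (1:ℝ))) • cross (t k) (y - waistPt Γ p t s₀ k))) +
      (1/2:ℝ) • y - α • crossCLM (EuclideanSpace.single 2 1) y := by
    funext y; rw [ambientField_eq Γ p t γ α s₀ ht j y, crossCLM_apply]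
  rw [hfun]
  refine ((ContDiff.sum fun k _ => ?_).add ((contDiff_const (c := (1/2:ℝ))).smul contDiff_id)).sub
    ((contDiff_const (c := α)).smul (crossCLM (EuclideanSpace.single 2 1)).contDiff)
  exact (contDiff_const (c := Γ*γ k/(4*Real.pi))).smul (contDiff_lineField coreConst_pos (waistPt Γ p t s₀ k) (t k) (ht k))

/-- **Size of the ambient field** seen from distance `≥ d > 0` of every partner line:
`‖W_j(y)‖ ≤ (Σ_{k ≠ j} (Γ|γ_k|/4π)·(2/d)) + (½ + |α|)‖y‖`. [folklore] -/
theorem norm_ambientField_le {N : ℕ} (Γ : ℝ) (p t : Fin N → EuclideanSpace ℝ (Fin 3)) (γ : Fin N → ℝ) (α : ℝ) (s₀ : Fin N → ℝ)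
    (ht : ∀ k, ‖t k‖ = 1) (j : Fin N) (y : EuclideanSpace ℝ (Fin 3)) {d : ℝ} (hd : 0 < d)
    (hfar : ∀ k, k ≠ j → d ^ 2 ≤ ‖y - waistPt Γ p t s₀ k‖ ^ 2 - (inner ℝ (y - waistPt Γ p t s₀ k) (t k)) ^ 2) :
    ‖ambientField Γ p t γ α s₀ j y‖ ≤ (∑ k ∈ Finset.univ.erase j, |Γ*γ k/(4*Real.pi)| * (2 / d)) + (1/2 + |α|) * ‖y‖ := by
  rw [ambientField_eq Γ p t γ α s₀ ht j y, add_sub_assoc]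
  refine (norm_add_le _ _).trans (add_le_add ?_ (norm_drift_le α y))
  refine (norm_sum_le _ _).trans (Finset.sum_le_sum fun k hk => ?_)
  rw [norm_smul, Real.norm_eq_abs]
  exact mul_le_mul_of_nonneg_left
    (norm_lineField_le coreConst_pos (waistPt Γ p t s₀ k) (t k) y (ht k) hd (hfar k (Finset.ne_of_mem_erase hk))) (abs_nonneg _)

/-! ## §2 The switch weight and the reference cutoff are smooth and `[0,1]`-valued -/

/-- The switch weight `switchWeight ℓ s` is `C^∞` in `y` (any `ℓ`, `s`). [folklore] -/
theorem contDiff_switchWeight (ℓ s : ℝ) {n : ℕ∞} : ContDiff ℝ n (switchWeight ℓ s) := by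
  unfold switchWeight switchProfile
  exact (Real.smoothTransition.contDiff (n := n)).comp
    (contDiff_const.sub ((((contDiff_norm_sq ℝ (E := EuclideanSpace ℝ (Fin 3))).div_const _).add
      contDiff_const).sub contDiff_const))

/-- The reference cutoff `refCutoff ℓ` is `C^∞`. [folklore] -/
theorem contDiff_refCutoff (ℓ : ℝ) {n : ℕ∞} : ContDiff ℝ n (refCutoff ℓ) :=
  contDiff_switchWeight ℓ (3/2)

/-- `0 ≤ switchWeight ℓ s y`. [folklore] -/
theorem switchWeight_nonneg (ℓ s : ℝ) (y : EuclideanSpace ℝ (Fin 3)) : 0 ≤ switchWeight ℓ s y :=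
  Real.smoothTransition.nonneg _

/-- `switchWeight ℓ s y ≤ 1`. [folklore] -/
theorem switchWeight_le_one (ℓ s : ℝ) (y : EuclideanSpace ℝ (Fin 3)) : switchWeight ℓ s y ≤ 1 :=
  Real.smoothTransition.le_one _

/-- `0 ≤ refCutoff ℓ y ≤ 1`. [folklore] -/
theorem refCutoff_mem_Icc (ℓ : ℝ) (y : EuclideanSpace ℝ (Fin 3)) : refCutoff ℓ y ∈ Icc (0:ℝ) 1 :=
  ⟨switchWeight_nonneg _ _ _, switchWeight_le_one _ _ _⟩

/-! ## §3 The LIA reference exists and is unique -/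

/-- **THE LIA REFERENCE EXISTS.**  For every straight datum with unit directions and all parameters `Γ, Rb, γ, α, s₀`, the cut-off local-induction
IVP `IsLiaReference Γ Rb p t γ α s₀ x` has a solution (filament by filament: `positionCutoffLia_exists` with `b = β_j⁻¹`, `φ` the reference cutoff,
`W` the ambient field — both `C^∞`). [folklore] -/
theorem liaReference_exists {N : ℕ} (Γ Rb : ℝ) (p t : Fin N → EuclideanSpace ℝ (Fin 3)) (γ : Fin N → ℝ) (α : ℝ) (s₀ : Fin N → ℝ)
    (ht : ∀ k, ‖t k‖ = 1) : ∃ x : Fin N → ℝ → EuclideanSpace ℝ (Fin 3), IsLiaReference Γ Rb p t γ α s₀ x := by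
  have h : ∀ j : Fin N, ∃ xj : ℝ → EuclideanSpace ℝ (Fin 3), ContDiff ℝ 2 xj ∧ xj 0 = waistPt Γ p t s₀ j ∧ deriv xj 0 = t j ∧
      (∀ τ, ‖deriv xj τ‖ = 1) ∧ ∀ τ, iteratedDeriv 2 xj τ =
        ((liaCoeff Γ γ j)⁻¹ * refCutoff (Rb * Real.sqrt (Γ * Real.log Γ)) (xj τ)) • cross (deriv xj τ) (ambientField Γ p t γ α s₀ j (xj τ)) :=
    fun j => positionCutoffLia_exists (contDiff_refCutoff _ (n := 1)) (contDiff_ambientField Γ p t γ α s₀ ht j) _ _ (ht j)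
  choose x hx using h
  exact ⟨x, fun j => ⟨(hx j).1, (hx j).2.2.2.1, (hx j).2.1, (hx j).2.2.1, (hx j).2.2.2.2⟩⟩

/-- **THE LIA REFERENCE IS UNIQUE** (unit datum directions). [folklore] -/
theorem liaReference_unique {N : ℕ} {Γ Rb : ℝ} {p t : Fin N → EuclideanSpace ℝ (Fin 3)} {γ : Fin N → ℝ} {α : ℝ} {s₀ : Fin N → ℝ}
    (ht : ∀ k, ‖t k‖ = 1) {x x' : Fin N → ℝ → EuclideanSpace ℝ (Fin 3)} (hx : IsLiaReference Γ Rb p t γ α s₀ x)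
    (hx' : IsLiaReference Γ Rb p t γ α s₀ x') : x = x' := by
  funext j
  obtain ⟨hC, -, h0, h0', hode⟩ := hx j
  obtain ⟨hC', -, h0x, h0x', hode'⟩ := hx' j
  exact positionCutoffLia_unique (contDiff_refCutoff _ (n := 1)) (contDiff_ambientField Γ p t γ α s₀ ht j)
    (liaCoeff Γ γ j)⁻¹ hC hC' (h0.trans h0x.symm) (h0'.trans h0x'.symm) hode hode'

/-! ## §4 Pointwise curvature and flatness of the reference -/

/-- **Curvature law.**  `‖x_j″ τ‖ ≤ |β_j⁻¹| · ‖W_j(x_j τ)‖` (the cutoff is in `[0,1]` and the tangent is a unit vector). [folklore] -/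
theorem IsLiaReference.norm_iteratedDeriv_two_le {N : ℕ} {Γ Rb : ℝ} {p t : Fin N → EuclideanSpace ℝ (Fin 3)} {γ : Fin N → ℝ} {α : ℝ}
    {s₀ : Fin N → ℝ} {x : Fin N → ℝ → EuclideanSpace ℝ (Fin 3)} (hx : IsLiaReference Γ Rb p t γ α s₀ x) (j : Fin N) (τ : ℝ) :
    ‖iteratedDeriv 2 (x j) τ‖ ≤ |(liaCoeff Γ γ j)⁻¹| * ‖ambientField Γ p t γ α s₀ j (x j τ)‖ := by
  obtain ⟨-, hunit, -, -, hode⟩ := hx j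
  rw [hode τ, norm_smul, Real.norm_eq_abs, abs_mul]
  have hφ := refCutoff_mem_Icc (Rb * Real.sqrt (Γ * Real.log Γ)) (x j τ)
  have hcr : ‖cross (deriv (x j) τ) (ambientField Γ p t γ α s₀ j (x j τ))‖ ≤ ‖ambientField Γ p t γ α s₀ j (x j τ)‖ := by
    have := norm_cross_le_norm_mul_norm (deriv (x j) τ) (ambientField Γ p t γ α s₀ j (x j τ))
    rwa [hunit τ, one_mul] at this
  rw [abs_of_nonneg hφ.1]
  calc |(liaCoeff Γ γ j)⁻¹| * refCutoff (Rb * Real.sqrt (Γ * Real.log Γ)) (x j τ) *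
        ‖cross (deriv (x j) τ) (ambientField Γ p t γ α s₀ j (x j τ))‖
      ≤ |(liaCoeff Γ γ j)⁻¹| * 1 * ‖ambientField Γ p t γ α s₀ j (x j τ)‖ :=
        mul_le_mul (mul_le_mul_of_nonneg_left hφ.2 (abs_nonneg _)) hcr (norm_nonneg _) (by positivity)
    _ = |(liaCoeff Γ γ j)⁻¹| * ‖ambientField Γ p t γ α s₀ j (x j τ)‖ := by rw [mul_one]

/-- **Straight arms.**  With `ℓ = Rb√(Γ log Γ) ≠ 0`, the reference curvature vanishes wherever `3ℓ² ≤ ‖x_j τ‖²`. [folklore] -/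
theorem IsLiaReference.iteratedDeriv_two_eq_zero {N : ℕ} {Γ Rb : ℝ} {p t : Fin N → EuclideanSpace ℝ (Fin 3)} {γ : Fin N → ℝ} {α : ℝ}
    {s₀ : Fin N → ℝ} {x : Fin N → ℝ → EuclideanSpace ℝ (Fin 3)} (hx : IsLiaReference Γ Rb p t γ α s₀ x)
    (hℓ : Rb * Real.sqrt (Γ * Real.log Γ) ≠ 0) (j : Fin N) {τ : ℝ} (hfar : 3 * (Rb * Real.sqrt (Γ * Real.log Γ)) ^ 2 ≤ ‖x j τ‖ ^ 2) :
    iteratedDeriv 2 (x j) τ = 0 := by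
  obtain ⟨-, -, -, -, hode⟩ := hx j
  rw [hode τ, refCutoff_eq_zero hℓ hfar, mul_zero, zero_smul]

end Summit.NavierStokesRegularity.NavierStokesRegularity.Theorems.SkeletonJ1RFrame

end
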